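import Literature.NumberTheory.LFunctions.MauduitRivatTypeIIS4Off
import HarnessLib

/-!
# Mauduit–Rivat's type-II estimate for unitary matrices: the chain (51)–(72) assembled (proved)

Everything in this file is PROVED (plus two plain abbreviations `scBound`, `smBound` for the
printed error terms). It strings together the layers of the proof of Prop. 2 of C. Mauduit,
J. Rivat, *Prime numbers along Rudin–Shapiro sequences*, J. Eur. Math. Soc. 17 (2015), §6
(matrix form: C. Müllner, Duke Math. J. 166 (2017), Prop. 5.5, §5.4.2), which are in the tree as
separate files, into inequalities free of the intermediate sums, with the parameters still free:

* `typeIISq_le_open` — (51)–(52) with the carry replacement (Lemma 5.2) and Cauchy–Schwarz: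
  `T ≤ (N'+R)/R · (M'N' + 4√d R #E + 2√(N' R Y))`, `Y = ∑_{r<R} ∑_n ‖Y_r(n)‖²`;
* `sum_innerY_le_vdC` — (53)–(54): `Y ≤ (M' + k^{μ₁}S)/S · (d R N' M' + 2 ∑_{s<S} |S₂'(s)|)`;
* `card_excP2_le_box`, `card_excP3_le_box`, `card_excP4_le_box` — the three remaining changes of
  variables for the exceptional sets of (62) (the first is `card_exc_le_box`);
* `scBound`, `card_box_le_scBound`, `norm_corrS2_sub_corrS3_le_sc` — (62)–(63) with the SHARP
  count of Lemma 9 (`card_box_midDigit_mem_le_sharp`): `|S₂'(s) − S₃(s)| ≤ 8 d R · scBound`;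
* `smBound`, `norm_corrS3_sub_corrS4_le_sm` — (64)–(70): `|S₃(s) − S₄(s)| ≤ 4 d R · smBound`;
* `norm_corrS4_le_sum` — (71)–(72): `|S₄(s)| ≤ ∑_{r<R} (|S₄'(r,s)| + |S₄''(r,s)|)`;
* **`sum_norm_corrS2_le_chain`** — all of the above summed over `1 ≤ s < S`:
  `∑_s |S₂'(s)| ≤ S (8dR·scBound + 4dR·smBound) + ∑_s∑_r |S₄'(r,s)| + ∑_s∑_r |S₄''(r,s)|`,
  ready for `sum_sum_norm_corrS4rDiag_le` ((73)–(84)) and `norm_corrS4rOff_le_n` ((85)).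

## References
* C. Mauduit, J. Rivat, J. Eur. Math. Soc. 17 (2015), §6, (51)–(72). [MauduitRivat2015]
* C. Müllner, Duke Math. J. 166 (2017) = arXiv:1602.03042, §5.4.2, Prop. 5.5. [Mullner2017]
-/

noncomputable section

open Finset Complex Matrix

open scoped FourierTransform InnerProductSpace ComplexConjugate Matrix.Norms.Frobenius

namespace Literature.NumberTheory.LFunctions.MauduitRivat

variable {d : Type*} [Fintype d] [DecidableEq d] {G : Type*} [Group G]

/-! ## (51)–(52): the opening -/

/-- `∑_{1≤r<R} √(Y r) ≤ √(R ∑_r Y r)` (Cauchy–Schwarz). [folklore] -/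
theorem sum_Ico_sqrt_le (R : ℕ) {Y : ℕ → ℝ} (hY : ∀ r, 0 ≤ Y r) :
    ∑ r ∈ Ico 1 R, Real.sqrt (Y r) ≤ Real.sqrt (R * ∑ r ∈ Ico 1 R, Y r) := by
  have h := Real.sum_mul_le_sqrt_mul_sqrt (Ico 1 R) (fun _ => (1 : ℝ)) (fun r => Real.sqrt (Y r))
  simp only [one_mul, one_pow, sum_const, Nat.card_Ico, nsmul_eq_mul, mul_one] at h
  have e : ∑ r ∈ Ico 1 R, Real.sqrt (Y r) ^ 2 = ∑ r ∈ Ico 1 R, Y r :=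
    sum_congr rfl fun r _ => Real.sq_sqrt (hY r)
  rw [e] at h
  rw [Real.sqrt_mul (Nat.cast_nonneg _)]
  refine h.trans (mul_le_mul_of_nonneg_right (Real.sqrt_le_sqrt ?_) (Real.sqrt_nonneg _))
  exact_mod_cast Nat.sub_le R 1

/-- **(51)–(52) opened**: for `k ≥ 2`, `‖B_n‖ ≤ 1`, `R = k^ρ`, on the k-adic box
`[k^{μ−1}, k^μ) × [k^{ν−1}, k^ν)`,
`T ≤ (N'+R)/R · (M'N' + 4√d R #E + 2√(N' · R · ∑_{r<R}∑_n ‖Y_r(n)‖²))`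
where `E` is the carry-exceptional set of the box (Lemma 5.2) and `Y_r` is built from `f_{μ+2ρ}`.
[cite: MauduitRivat2015, (51)–(52)] [cite: Mullner2017, §5.4.2] -/
theorem typeIISq_le_open (U : G →* unitaryGroup d ℂ) (f : ℕ → G) {k : ℕ} (hk : 2 ≤ k) (ϑ : ℝ)
    {B : ℕ → Matrix d d ℂ} (hB : ∀ n, ‖B n‖ ≤ 1) (μ ν ρ : ℕ) :
    typeIISq ϑ B (umat U f) (k ^ (μ - 1)) (k ^ μ) (k ^ (ν - 1)) (k ^ ν) ≤
      ((((k ^ ν - k ^ (ν - 1) : ℕ) : ℝ) + (k ^ ρ : ℕ)) / (k ^ ρ : ℕ)) *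
        (((k ^ μ - k ^ (μ - 1) : ℕ) : ℝ) * ((k ^ ν - k ^ (ν - 1) : ℕ) : ℝ) +
          4 * Real.sqrt (Fintype.card d) * (k ^ ρ : ℕ) * (carryExceptionsBox k f μ ν ρ).card +
          2 * Real.sqrt (((k ^ ν - k ^ (ν - 1) : ℕ) : ℝ) * ((k ^ ρ : ℕ) *
            ∑ r ∈ Ico 1 (k ^ ρ), ∑ n ∈ Ico (k ^ (ν - 1)) (k ^ ν),
              ‖innerY ϑ (umat U (trunc k (μ + 2 * ρ) f)) (k ^ (μ - 1)) (k ^ μ) r n‖ ^ 2))) := by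
  have hk0 : 0 < k := by omega
  set M₀ := k ^ (μ - 1) with hM₀
  set M₁ := k ^ μ with hM₁
  set N₀ := k ^ (ν - 1) with hN₀
  set N₁ := k ^ ν with hN₁
  set R := k ^ ρ with hR
  have hR1 : 1 ≤ R := Nat.one_le_pow _ _ hk0
  have hRpos : (0 : ℝ) < R := by exact_mod_cast hR1
  have hN : N₀ ≤ N₁ := Nat.pow_le_pow_right hk0 (Nat.sub_le _ _)
  set N' : ℝ := ((N₁ - N₀ : ℕ) : ℝ) with hN'
  set M' : ℝ := ((M₁ - M₀ : ℕ) : ℝ) with hM'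
  have hN'0 : 0 ≤ N' := Nat.cast_nonneg _
  have hM'0 : 0 ≤ M' := Nat.cast_nonneg _
  set F₂ := umat U (trunc k (μ + 2 * ρ) f) with hF₂
  set Y : ℕ → ℝ := fun r => ∑ n ∈ Ico N₀ N₁, ‖innerY ϑ F₂ M₀ M₁ r n‖ ^ 2 with hY
  have hY0 : ∀ r, 0 ≤ Y r := fun r => sum_nonneg fun _ _ => by positivity
  set EB : ℝ := ((carryExceptionsBox k f μ ν ρ).card : ℝ) with hEB
  -- van der Corput over `n`
  have h1 := sq_typeIISq_le U f ϑ B hN hR1 (M₀ := M₀) (M₁ := M₁)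
  -- the `B`-sum
  have hBsum : ∑ n ∈ Ico N₀ N₁, ‖B n‖ ^ 2 ≤ N' := by
    calc ∑ n ∈ Ico N₀ N₁, ‖B n‖ ^ 2 ≤ ∑ _n ∈ Ico N₀ N₁, (1 : ℝ) :=
          sum_le_sum fun n _ => by
            have := hB n; have := norm_nonneg (B n); nlinarith
      _ = N' := by rw [sum_const, Nat.card_Ico, nsmul_eq_mul, mul_one]
  -- each `S₁(r)`
  have hS1 : ∀ r ∈ Ico 1 R, ‖corrS1 ϑ B (umat U f) M₀ M₁ N₀ N₁ r‖ ≤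
      2 * Real.sqrt (Fintype.card d) * EB + Real.sqrt N' * Real.sqrt (Y r) := by
    intro r hr
    rw [mem_Ico] at hr
    have hsub := norm_corrS1_sub_le U f ϑ B k μ ν ρ hr.2
    have hmain := norm_corrS1_le ϑ B F₂ M₀ M₁ N₀ N₁ r
    have hE : ∑ p ∈ carryExceptionsBox k f μ ν ρ, ‖B (p.2 + r)‖ * ‖B p.2‖ ≤ EB := by
      calc ∑ p ∈ carryExceptionsBox k f μ ν ρ, ‖B (p.2 + r)‖ * ‖B p.2‖
          ≤ ∑ _p ∈ carryExceptionsBox k f μ ν ρ, (1 : ℝ) :=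
            sum_le_sum fun p _ => by
              have h1 := hB (p.2 + r); have h2 := hB p.2
              exact mul_le_one₀ h1 (norm_nonneg _) h2
        _ = EB := by rw [sum_const, nsmul_eq_mul, mul_one]
    have hBB : Real.sqrt (∑ n ∈ Ico N₀ N₁, (‖B (n + r)‖ * ‖B n‖) ^ 2) ≤ Real.sqrt N' := by
      refine Real.sqrt_le_sqrt ?_
      calc ∑ n ∈ Ico N₀ N₁, (‖B (n + r)‖ * ‖B n‖) ^ 2 ≤ ∑ _n ∈ Ico N₀ N₁, (1 : ℝ) :=
            sum_le_sum fun n _ => by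
              have h1 := hB (n + r); have h2 := hB n
              have h3 : ‖B (n + r)‖ * ‖B n‖ ≤ 1 := mul_le_one₀ h1 (norm_nonneg _) h2
              have h4 : 0 ≤ ‖B (n + r)‖ * ‖B n‖ := by positivity
              nlinarith
        _ = N' := by rw [sum_const, Nat.card_Ico, nsmul_eq_mul, mul_one]
    calc ‖corrS1 ϑ B (umat U f) M₀ M₁ N₀ N₁ r‖
        ≤ ‖corrS1 ϑ B F₂ M₀ M₁ N₀ N₁ r‖ +
            ‖corrS1 ϑ B (umat U f) M₀ M₁ N₀ N₁ r - corrS1 ϑ B F₂ M₀ M₁ N₀ N₁ r‖ :=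
          norm_le_norm_add_norm_sub' _ _
      _ ≤ Real.sqrt N' * Real.sqrt (Y r) + 2 * Real.sqrt (Fintype.card d) * EB := by
          refine add_le_add (hmain.trans ?_) (hsub.trans ?_)
          · exact mul_le_mul_of_nonneg_right hBB (Real.sqrt_nonneg _)
          · exact mul_le_mul_of_nonneg_left hE (by positivity)
      _ = _ := by ring
  -- sum over `r`
  have hsumS1 : ∑ r ∈ Ico 1 R, ‖corrS1 ϑ B (umat U f) M₀ M₁ N₀ N₁ r‖ ≤
      2 * Real.sqrt (Fintype.card d) * R * EB + Real.sqrt N' * Real.sqrt (R * ∑ r ∈ Ico 1 R, Y r) := by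
    refine (sum_le_sum hS1).trans ?_
    rw [sum_add_distrib, sum_const, Nat.card_Ico, nsmul_eq_mul, ← mul_sum]
    refine add_le_add ?_ (mul_le_mul_of_nonneg_left (sum_Ico_sqrt_le R hY0) (Real.sqrt_nonneg _))
    have : ((R - 1 : ℕ) : ℝ) ≤ R := by exact_mod_cast Nat.sub_le R 1
    have h0 : 0 ≤ 2 * Real.sqrt (Fintype.card d) * EB := by positivity
    nlinarith
  -- divide by `R²`
  have hT0 : 0 ≤ typeIISq ϑ B (umat U f) M₀ M₁ N₀ N₁ := sum_nonneg fun _ _ => by positivity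
  have hRHS : (N' + R) * (R * (M' * ∑ n ∈ Ico N₀ N₁, ‖B n‖ ^ 2 +
      2 * ∑ r ∈ Ico 1 R, ‖corrS1 ϑ B (umat U f) M₀ M₁ N₀ N₁ r‖)) ≤
      (N' + R) * (R * (M' * N' + 2 * (2 * Real.sqrt (Fintype.card d) * R * EB +
        Real.sqrt N' * Real.sqrt (R * ∑ r ∈ Ico 1 R, Y r)))) := by
    have h2 : M' * ∑ n ∈ Ico N₀ N₁, ‖B n‖ ^ 2 ≤ M' * N' := mul_le_mul_of_nonneg_left hBsum hM'0
    have h3 := hsumS1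
    have hNR : 0 ≤ N' + R := by positivity
    refine mul_le_mul_of_nonneg_left (mul_le_mul_of_nonneg_left ?_ hRpos.le) hNR
    linarith
  have key := h1.trans hRHS
  rw [Real.sqrt_mul hN'0]
  calc typeIISq ϑ B (umat U f) M₀ M₁ N₀ N₁
      = ((R : ℝ) ^ 2 * typeIISq ϑ B (umat U f) M₀ M₁ N₀ N₁) / (R : ℝ) ^ 2 := by
        field_simp
    _ ≤ (N' + R) * (R * (M' * N' + 2 * (2 * Real.sqrt (Fintype.card d) * R * EB +
        Real.sqrt N' * Real.sqrt (R * ∑ r ∈ Ico 1 R, Y r)))) / (R : ℝ) ^ 2 :=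
        div_le_div_of_nonneg_right key (by positivity)
    _ = _ := by
        field_simp
        ring

/-! ## (53)–(54): the second van der Corput step -/

/-- **(53)–(54)**: for `S ≥ 1`, `k ≥ 1`, `M₀ ≤ M₁`,
`∑_{r<R}∑_n ‖Y_r(n)‖² ≤ (M' + k^{μ₁}S)/S · (d R N' M' + 2 ∑_{1≤s<S} |S₂'(s)|)`
(`sq_sum_innerY_le` divided by `S²`, `R − 1 ≤ R`). [cite: MauduitRivat2015, (53)–(54)] -/
theorem sum_innerY_le_vdC (U : G →* unitaryGroup d ℂ) (f : ℕ → G) (ϑ : ℝ) {M₀ M₁ : ℕ}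
    (hM : M₀ ≤ M₁) (N₀ N₁ R L : ℕ) {S : ℕ} (hS : 1 ≤ S) (hL : 1 ≤ L) :
    ∑ r ∈ Ico 1 R, ∑ n ∈ Ico N₀ N₁, ‖innerY ϑ (umat U f) M₀ M₁ r n‖ ^ 2 ≤
      ((((M₁ - M₀ : ℕ) : ℝ) + L * S) / S) *
        ((Fintype.card d : ℝ) * R * ((N₁ - N₀ : ℕ) : ℝ) * ((M₁ - M₀ : ℕ) : ℝ) +
          2 * ∑ s ∈ Ico 1 S, ‖corrS2 ϑ (umat U f) M₀ M₁ N₀ N₁ R L s‖) := by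
  have h := sq_sum_innerY_le U f ϑ hM N₀ N₁ R hS hL
  have hSpos : (0 : ℝ) < S := by exact_mod_cast hS
  have hR : ((R - 1 : ℕ) : ℝ) ≤ R := by exact_mod_cast Nat.sub_le R 1
  set Y := ∑ r ∈ Ico 1 R, ∑ n ∈ Ico N₀ N₁, ‖innerY ϑ (umat U f) M₀ M₁ r n‖ ^ 2 with hY
  set X := ∑ s ∈ Ico 1 S, ‖corrS2 ϑ (umat U f) M₀ M₁ N₀ N₁ R L s‖ with hX
  have hX0 : 0 ≤ X := sum_nonneg fun _ _ => norm_nonneg _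
  have h2 : (S : ℝ) ^ 2 * Y ≤ ((((M₁ - M₀ : ℕ) : ℝ) + L * S)) * (S *
      ((Fintype.card d : ℝ) * R * ((N₁ - N₀ : ℕ) : ℝ) * ((M₁ - M₀ : ℕ) : ℝ) + 2 * X)) := by
    refine h.trans (mul_le_mul_of_nonneg_left (mul_le_mul_of_nonneg_left ?_ hSpos.le) (by positivity))
    have : (0 : ℝ) ≤ (Fintype.card d : ℝ) * ((N₁ - N₀ : ℕ) : ℝ) * ((M₁ - M₀ : ℕ) : ℝ) := by positivity
    nlinarith
  calc Y = (S : ℝ) ^ 2 * Y / (S : ℝ) ^ 2 := by field_simp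
    _ ≤ ((((M₁ - M₀ : ℕ) : ℝ) + L * S)) * (S *
      ((Fintype.card d : ℝ) * R * ((N₁ - N₀ : ℕ) : ℝ) * ((M₁ - M₀ : ℕ) : ℝ) + 2 * X)) / (S : ℝ) ^ 2 :=
        div_le_div_of_nonneg_right h2 (by positivity)
    _ = _ := by field_simp

/-! ## (62): the four exceptional sets as box counts -/

/-- Change of variables `(n, m) ↦ (m + L, n)` for the condition on `(m+L)n`. [folklore] -/
theorem card_excP2_le_box {k μ₀ μ₂ : ℕ} (B : Finset ℕ) {M₀ M₁ N₀ N₁ : ℕ} (hN : N₀ ≤ N₁) (L : ℕ) :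
    (((Ico N₀ N₁) ×ˢ ((Ico M₀ M₁).filter (fun m => m + L < M₁))).filter fun p : ℕ × ℕ =>
        midDigit k μ₀ μ₂ ((p.2 + L) * p.1) ∈ B).card ≤
      (((Ico (M₀ + L) M₁) ×ˢ (Ico N₀ (N₀ + (N₁ - N₀)))).filter fun p : ℕ × ℕ =>
        midDigit k μ₀ μ₂ (p.1 * p.2 + 0) ∈ B).card := by
  refine card_le_card_of_injOn (fun p => (p.2 + L, p.1)) (fun p hp => ?_) (fun p hp p' hp' h => ?_)
  · rw [mem_coe, mem_filter, mem_product, mem_Ico, mem_filter, mem_Ico] at hp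
    dsimp only
    rw [mem_coe, mem_filter, mem_product, mem_Ico, mem_Ico, add_zero]
    exact ⟨⟨⟨by omega, hp.1.2.2⟩, by omega, by omega⟩, hp.2⟩
  · simp only [Prod.mk.injEq] at h
    exact Prod.ext (by omega) (by omega)

/-- Change of variables `(n, m) ↦ (m, n)` for the condition on `mn`. [folklore] -/
theorem card_excP3_le_box {k μ₀ μ₂ : ℕ} (B : Finset ℕ) {M₀ M₁ N₀ N₁ : ℕ} (hN : N₀ ≤ N₁) (L : ℕ) :
    (((Ico N₀ N₁) ×ˢ ((Ico M₀ M₁).filter (fun m => m + L < M₁))).filter fun p : ℕ × ℕ =>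
        midDigit k μ₀ μ₂ (p.2 * p.1) ∈ B).card ≤
      (((Ico M₀ M₁) ×ˢ (Ico N₀ (N₀ + (N₁ - N₀)))).filter fun p : ℕ × ℕ =>
        midDigit k μ₀ μ₂ (p.1 * p.2 + 0) ∈ B).card := by
  refine card_le_card_of_injOn (fun p => (p.2, p.1)) (fun p hp => ?_) (fun p hp p' hp' h => ?_)
  · rw [mem_coe, mem_filter, mem_product, mem_Ico, mem_filter, mem_Ico] at hp
    dsimp only
    rw [mem_coe, mem_filter, mem_product, mem_Ico, mem_Ico, add_zero]
    exact ⟨⟨⟨hp.1.2.1.1, hp.1.2.1.2⟩, by omega, by omega⟩, hp.2⟩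
  · simp only [Prod.mk.injEq] at h
    exact Prod.ext h.2 h.1

/-- Change of variables `(n, m) ↦ (m, n + r)` for the condition on `m(n+r)`. [folklore] -/
theorem card_excP4_le_box {k μ₀ μ₂ : ℕ} (B : Finset ℕ) {M₀ M₁ N₀ N₁ : ℕ} (hN : N₀ ≤ N₁) (L r : ℕ) :
    (((Ico N₀ N₁) ×ˢ ((Ico M₀ M₁).filter (fun m => m + L < M₁))).filter fun p : ℕ × ℕ =>
        midDigit k μ₀ μ₂ (p.2 * (p.1 + r)) ∈ B).card ≤
      (((Ico M₀ M₁) ×ˢ (Ico (N₀ + r) (N₀ + r + (N₁ - N₀)))).filter fun p : ℕ × ℕ =>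
        midDigit k μ₀ μ₂ (p.1 * p.2 + 0) ∈ B).card := by
  refine card_le_card_of_injOn (fun p => (p.2, p.1 + r)) (fun p hp => ?_) (fun p hp p' hp' h => ?_)
  · rw [mem_coe, mem_filter, mem_product, mem_Ico, mem_filter, mem_Ico] at hp
    dsimp only
    rw [mem_coe, mem_filter, mem_product, mem_Ico, mem_Ico, add_zero]
    exact ⟨⟨⟨hp.1.2.1.1, hp.1.2.1.2⟩, by omega, by omega⟩, hp.2⟩
  · simp only [Prod.mk.injEq] at h
    exact Prod.ext (by omega) h.1

/-! ## (62)–(63) with the sharp count of Lemma 9 -/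

/-- The right-hand side of the sharp Lemma 9 (`card_box_midDigit_mem_le_sharp`) as a function of a
bound `nB` for `#B`, the `m`-length `Mlen`, the upper end `M₁` and the `n`-length `N`
(`K = k^{μ₂}`, `L = k^{μ₀}`):
`2 nB (L/K) Mlen N + 4 nB (M₁/K+1)(1+log K)(2Nτ(K) + 2L + K(1+log K)) + 2 Mlen (N/L+3) + 8τ(L)M₁N/L`.
[cite: MauduitRivat2015, Lemma 9] -/
def scBound (k μ₀ μ₂ : ℕ) (nB : ℝ) (Mlen M₁ N : ℕ) : ℝ :=
  2 * (((k ^ μ₀ : ℕ) : ℝ) / (k ^ μ₂ : ℕ) * nB * (Mlen : ℝ) * N) +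
    4 * nB * ((M₁ / k ^ μ₂ + 1 : ℕ) : ℝ) * (1 + Real.log ((k ^ μ₂ : ℕ) : ℝ)) *
      (2 * N * ((k ^ μ₂).divisors.card : ℝ) + 2 * (k ^ μ₀ : ℕ) +
        (k ^ μ₂ : ℕ) * (1 + Real.log ((k ^ μ₂ : ℕ) : ℝ))) +
    (2 * (Mlen : ℝ) * ((N : ℝ) / (k ^ μ₀ : ℕ) + 3) +
      8 * ((k ^ μ₀).divisors.card : ℝ) * M₁ * N / (k ^ μ₀ : ℕ))

omit [DecidableEq d] in
/-- `scBound ≥ 0` for `nB ≥ 0`. [folklore] -/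
theorem scBound_nonneg (k μ₀ μ₂ : ℕ) {nB : ℝ} (hnB : 0 ≤ nB) (Mlen M₁ N : ℕ) :
    0 ≤ scBound k μ₀ μ₂ nB Mlen M₁ N := by
  unfold scBound
  have : (0 : ℝ) ≤ Real.log ((k ^ μ₂ : ℕ) : ℝ) := Real.log_natCast_nonneg _
  positivity

/-- **The sharp Lemma 9 in monotone form**: for `B ⊆ [0, k^{μ₂−μ₀})` with `#B ≤ nB`,
`1 ≤ M₀'`, `M₀ ≤ M₀'`, the pairs `(m,n) ∈ [M₀',M₁) × [N₀, N₀+N)` with `r_{μ₀,μ₂}(mn) ∈ B` number at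
most `scBound k μ₀ μ₂ nB (M₁−M₀) M₁ N`. [cite: MauduitRivat2015, Lemma 9] -/
theorem card_box_le_scBound {k : ℕ} (hk : 0 < k) {μ₀ μ₂ : ℕ} (hμ : μ₀ ≤ μ₂) {B : Finset ℕ}
    (hB : ∀ u ∈ B, u < k ^ (μ₂ - μ₀)) {nB : ℝ} (hnB : (B.card : ℝ) ≤ nB) {M₀ M₀' M₁ : ℕ}
    (hM₀ : 1 ≤ M₀') (hMM : M₀ ≤ M₀') (N₀ N : ℕ) :
    ((((Ico M₀' M₁) ×ˢ (Ico N₀ (N₀ + N))).filter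
        (fun p : ℕ × ℕ => midDigit k μ₀ μ₂ (p.1 * p.2 + 0) ∈ B)).card : ℝ) ≤
      scBound k μ₀ μ₂ nB (M₁ - M₀) M₁ N := by
  refine (card_box_midDigit_mem_le_sharp hk hμ hB 0 hM₀ N₀ N (M₁ := M₁)).trans ?_
  unfold scBound
  have hlog : (0 : ℝ) ≤ Real.log ((k ^ μ₂ : ℕ) : ℝ) := Real.log_natCast_nonneg _
  have hM : ((M₁ - M₀' : ℕ) : ℝ) ≤ ((M₁ - M₀ : ℕ) : ℝ) := by exact_mod_cast Nat.sub_le_sub_left hMM M₁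
  have hB0 : (0 : ℝ) ≤ B.card := Nat.cast_nonneg _
  have hnB0 : 0 ≤ nB := hB0.trans hnB
  gcongr

/-- **(62)–(63), sharp**: for `k ≥ 1`, `μ₀ ≤ μ₁ < μ₂`... (only `μ₀ ≤ μ₁ ≤ μ₂` is used here),
`1 ≤ M₀ ≤ M₁`, `N₀ ≤ N₁` and `#(midViolations) ≤ nB`,
`|S₂'(s) − S₃(s)| ≤ 8 d R · scBound k μ₀ μ₂ nB (M₁−M₀) M₁ (N₁−N₀)`.
[cite: MauduitRivat2015, (62)–(63)] [cite: Mullner2017, Lemma 5.3] -/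
theorem norm_corrS2_sub_corrS3_le_sc (U : G →* unitaryGroup d ℂ) (f : ℕ → G) {k : ℕ} (hk : 0 < k)
    {μ₀ μ₁ μ₂ : ℕ} (h01 : μ₀ ≤ μ₁) (h12 : μ₁ ≤ μ₂) (ϑ : ℝ) {M₀ M₁ N₀ N₁ : ℕ} (hM₀ : 1 ≤ M₀)
    (hN : N₀ ≤ N₁) (R s : ℕ) {nB : ℝ} (hnB : ((midViolations k μ₀ μ₁ μ₂ f).card : ℝ) ≤ nB) :
    ‖corrS2 ϑ (umat U (trunc k μ₂ f)) M₀ M₁ N₀ N₁ R (k ^ μ₁) s -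
        corrS3 U f k μ₀ μ₁ μ₂ ϑ M₀ M₁ N₀ N₁ R s‖ ≤
      8 * Fintype.card d * R * scBound k μ₀ μ₂ nB (M₁ - M₀) M₁ (N₁ - N₀) := by
  have h02 : μ₀ ≤ μ₂ := h01.trans h12
  set Bv := midViolations k μ₀ μ₁ μ₂ f with hBv
  have hBv : ∀ u ∈ Bv, u < k ^ (μ₂ - μ₀) := fun u hu => (mem_carryViolations.1 hu).1
  have hnB0 : 0 ≤ nB := le_trans (Nat.cast_nonneg _) hnB
  set SC := scBound k μ₀ μ₂ nB (M₁ - M₀) M₁ (N₁ - N₀) with hSC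
  have hSC0 : 0 ≤ SC := scBound_nonneg k μ₀ μ₂ hnB0 _ _ _
  refine (norm_corrS2_sub_corrS3_le U f hk h01 h12 ϑ M₀ M₁ N₀ N₁ R s).trans ?_
  -- each `r`: four box counts
  have hr : ∀ r ∈ Ico 1 R,
      ((((Ico N₀ N₁) ×ˢ ((Ico M₀ M₁).filter (fun m => m + s * k ^ μ₁ < M₁))).filter fun p : ℕ × ℕ =>
          midDigit k μ₀ μ₂ ((p.2 + s * k ^ μ₁) * (p.1 + r)) ∈ Bv ∨
          midDigit k μ₀ μ₂ ((p.2 + s * k ^ μ₁) * p.1) ∈ Bv ∨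
          midDigit k μ₀ μ₂ (p.2 * p.1) ∈ Bv ∨
          midDigit k μ₀ μ₂ (p.2 * (p.1 + r)) ∈ Bv).card : ℝ) ≤ 4 * SC := by
    intro r _
    have hM₀' : 1 ≤ M₀ + s * k ^ μ₁ := le_add_right hM₀
    have c1 := card_exc_le_box (k := k) (μ₀ := μ₀) (μ₂ := μ₂) Bv hN (s * k ^ μ₁) r (M₀ := M₀) (M₁ := M₁)
    have c2 := card_excP2_le_box (k := k) (μ₀ := μ₀) (μ₂ := μ₂) Bv hN (s * k ^ μ₁) (M₀ := M₀) (M₁ := M₁)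
    have c3 := card_excP3_le_box (k := k) (μ₀ := μ₀) (μ₂ := μ₂) Bv hN (s * k ^ μ₁) (M₀ := M₀) (M₁ := M₁)
    have c4 := card_excP4_le_box (k := k) (μ₀ := μ₀) (μ₂ := μ₂) Bv hN (s * k ^ μ₁) r (M₀ := M₀) (M₁ := M₁)
    have b1 := card_box_le_scBound hk h02 hBv hnB hM₀' (Nat.le_add_right M₀ _) (N₀ + r) (N₁ - N₀) (M₁ := M₁)
    have b2 := card_box_le_scBound hk h02 hBv hnB hM₀' (Nat.le_add_right M₀ _) N₀ (N₁ - N₀) (M₁ := M₁)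
    have b3 := card_box_le_scBound hk h02 hBv hnB hM₀ le_rfl N₀ (N₁ - N₀) (M₁ := M₁)
    have b4 := card_box_le_scBound hk h02 hBv hnB hM₀ le_rfl (N₀ + r) (N₁ - N₀) (M₁ := M₁)
    have hfour := card_filter_or_four_le
      ((Ico N₀ N₁) ×ˢ ((Ico M₀ M₁).filter (fun m => m + s * k ^ μ₁ < M₁)))
      (fun p : ℕ × ℕ => midDigit k μ₀ μ₂ ((p.2 + s * k ^ μ₁) * (p.1 + r)) ∈ Bv)
      (fun p : ℕ × ℕ => midDigit k μ₀ μ₂ ((p.2 + s * k ^ μ₁) * p.1) ∈ Bv)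
      (fun p : ℕ × ℕ => midDigit k μ₀ μ₂ (p.2 * p.1) ∈ Bv)
      (fun p : ℕ × ℕ => midDigit k μ₀ μ₂ (p.2 * (p.1 + r)) ∈ Bv)
    have e1 : ((((Ico N₀ N₁) ×ˢ ((Ico M₀ M₁).filter (fun m => m + s * k ^ μ₁ < M₁))).filter fun p : ℕ × ℕ =>
        midDigit k μ₀ μ₂ ((p.2 + s * k ^ μ₁) * (p.1 + r)) ∈ Bv).card : ℝ) ≤ SC :=
      le_trans (by exact_mod_cast c1) b1
    have e2 : ((((Ico N₀ N₁) ×ˢ ((Ico M₀ M₁).filter (fun m => m + s * k ^ μ₁ < M₁))).filter fun p : ℕ × ℕ =>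
        midDigit k μ₀ μ₂ ((p.2 + s * k ^ μ₁) * p.1) ∈ Bv).card : ℝ) ≤ SC :=
      le_trans (by exact_mod_cast c2) b2
    have e3 : ((((Ico N₀ N₁) ×ˢ ((Ico M₀ M₁).filter (fun m => m + s * k ^ μ₁ < M₁))).filter fun p : ℕ × ℕ =>
        midDigit k μ₀ μ₂ (p.2 * p.1) ∈ Bv).card : ℝ) ≤ SC :=
      le_trans (by exact_mod_cast c3) b3
    have e4 : ((((Ico N₀ N₁) ×ˢ ((Ico M₀ M₁).filter (fun m => m + s * k ^ μ₁ < M₁))).filter fun p : ℕ × ℕ =>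
        midDigit k μ₀ μ₂ (p.2 * (p.1 + r)) ∈ Bv).card : ℝ) ≤ SC :=
      le_trans (by exact_mod_cast c4) b4
    have hfour' : ((((Ico N₀ N₁) ×ˢ ((Ico M₀ M₁).filter (fun m => m + s * k ^ μ₁ < M₁))).filter fun p : ℕ × ℕ =>
          midDigit k μ₀ μ₂ ((p.2 + s * k ^ μ₁) * (p.1 + r)) ∈ Bv ∨
          midDigit k μ₀ μ₂ ((p.2 + s * k ^ μ₁) * p.1) ∈ Bv ∨
          midDigit k μ₀ μ₂ (p.2 * p.1) ∈ Bv ∨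
          midDigit k μ₀ μ₂ (p.2 * (p.1 + r)) ∈ Bv).card : ℝ) ≤
        (((Ico N₀ N₁) ×ˢ ((Ico M₀ M₁).filter (fun m => m + s * k ^ μ₁ < M₁))).filter fun p : ℕ × ℕ =>
          midDigit k μ₀ μ₂ ((p.2 + s * k ^ μ₁) * (p.1 + r)) ∈ Bv).card +
        (((Ico N₀ N₁) ×ˢ ((Ico M₀ M₁).filter (fun m => m + s * k ^ μ₁ < M₁))).filter fun p : ℕ × ℕ =>
          midDigit k μ₀ μ₂ ((p.2 + s * k ^ μ₁) * p.1) ∈ Bv).card +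
        (((Ico N₀ N₁) ×ˢ ((Ico M₀ M₁).filter (fun m => m + s * k ^ μ₁ < M₁))).filter fun p : ℕ × ℕ =>
          midDigit k μ₀ μ₂ (p.2 * p.1) ∈ Bv).card +
        (((Ico N₀ N₁) ×ˢ ((Ico M₀ M₁).filter (fun m => m + s * k ^ μ₁ < M₁))).filter fun p : ℕ × ℕ =>
          midDigit k μ₀ μ₂ (p.2 * (p.1 + r)) ∈ Bv).card := by
      exact_mod_cast hfour
    linarith
  calc 2 * (Fintype.card d : ℝ) * ∑ r ∈ Ico 1 R,
        ((((Ico N₀ N₁) ×ˢ ((Ico M₀ M₁).filter (fun m => m + s * k ^ μ₁ < M₁))).filter fun p : ℕ × ℕ =>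
          midDigit k μ₀ μ₂ ((p.2 + s * k ^ μ₁) * (p.1 + r)) ∈ Bv ∨
          midDigit k μ₀ μ₂ ((p.2 + s * k ^ μ₁) * p.1) ∈ Bv ∨
          midDigit k μ₀ μ₂ (p.2 * p.1) ∈ Bv ∨
          midDigit k μ₀ μ₂ (p.2 * (p.1 + r)) ∈ Bv).card : ℝ)
      ≤ 2 * (Fintype.card d : ℝ) * ∑ _r ∈ Ico 1 R, 4 * SC :=
        mul_le_mul_of_nonneg_left (sum_le_sum hr) (by positivity)
    _ = 2 * (Fintype.card d : ℝ) * (((R - 1 : ℕ) : ℝ) * (4 * SC)) := by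
        rw [sum_const, Nat.card_Ico, nsmul_eq_mul]
    _ ≤ 2 * (Fintype.card d : ℝ) * ((R : ℝ) * (4 * SC)) := by
        have : ((R - 1 : ℕ) : ℝ) ≤ R := by exact_mod_cast Nat.sub_le R 1
        gcongr
    _ = _ := by ring

/-! ## (64)–(70): the smoothing error -/

/-- The right-hand side of `sum_box_min_le` (the smoothing error over a box) as a function of
`X = K/H`, the window `W`, the `m`-length `Mlen`, the upper end `M₁` and the `n`-length `N`
(`L = k^{μ₀}`): `2 Mlen (NW/L + W + 2) + 8τ(L)M₁N/L + (X/W) Mlen N`.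
[cite: MauduitRivat2015, (69)–(70)] -/
def smBound (k μ₀ : ℕ) (X : ℝ) (W Mlen M₁ N : ℕ) : ℝ :=
  2 * (Mlen : ℝ) * ((N : ℝ) * W / (k ^ μ₀ : ℕ) + W + 2) +
    8 * ((k ^ μ₀).divisors.card : ℝ) * M₁ * N / (k ^ μ₀ : ℕ) + X / W * ((Mlen : ℝ) * N)

omit [DecidableEq d] in
/-- `smBound ≥ 0` for `X ≥ 0`. [folklore] -/
theorem smBound_nonneg (k μ₀ : ℕ) {X : ℝ} (hX : 0 ≤ X) (W Mlen M₁ N : ℕ) :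
    0 ≤ smBound k μ₀ X W Mlen M₁ N := by
  unfold smBound; positivity

/-- The double sum of `S₃ − S₄` over `(n, m)` is dominated by the box sum of `sum_box_min_le`
(drop the constraint on `m`, shift `n` by `r`). [folklore] -/
theorem sum_sum_filter_min_le_box {k μ₀ : ℕ} (hk : 0 < k) {X : ℝ} (hX : 0 ≤ X) {W : ℕ} (hW : 1 ≤ W)
    {M₀ M₁ N₀ N₁ : ℕ} (hM₀ : 1 ≤ M₀) (hN : N₀ ≤ N₁) (L r : ℕ) :
    ∑ n ∈ Ico N₀ N₁, ∑ m ∈ (Ico M₀ M₁).filter (fun m => m + L < M₁),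
        min 1 (X / (gridDist (k ^ μ₀) (m * n + m * r) : ℝ)) ≤
      smBound k μ₀ X W (M₁ - M₀) M₁ (N₁ - N₀) := by
  have hL : 0 < k ^ μ₀ := by positivity
  have hnn : ∀ x : ℕ, 0 ≤ min 1 (X / (gridDist (k ^ μ₀) x : ℝ)) := fun x => by positivity
  calc ∑ n ∈ Ico N₀ N₁, ∑ m ∈ (Ico M₀ M₁).filter (fun m => m + L < M₁),
        min 1 (X / (gridDist (k ^ μ₀) (m * n + m * r) : ℝ))
      ≤ ∑ n ∈ Ico N₀ N₁, ∑ m ∈ Ico M₀ M₁, min 1 (X / (gridDist (k ^ μ₀) (m * n + m * r) : ℝ)) :=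
        sum_le_sum fun n _ => sum_le_sum_of_subset_of_nonneg (filter_subset _ _) fun m _ _ => hnn _
    _ = ∑ p ∈ (Ico M₀ M₁) ×ˢ (Ico (N₀ + r) (N₀ + r + (N₁ - N₀))),
          min 1 (X / (gridDist (k ^ μ₀) (p.1 * p.2 + 0) : ℝ)) := by
        rw [sum_product, sum_comm]
        have e : Ico (N₀ + r) (N₀ + r + (N₁ - N₀)) = (Ico N₀ N₁).map (addRightEmbedding r) := by
          rw [Finset.map_add_right_Ico]; congr 1; omega
        rw [e]
        refine sum_congr rfl fun m _ => ?_
        rw [sum_map]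
        refine sum_congr rfl fun n _ => ?_
        simp only [addRightEmbedding_apply, add_zero, mul_add]
    _ ≤ _ := by
        have h := sum_box_min_le hL hX hW 0 hM₀ (N₀ + r) (N₁ - N₀) (M₁ := M₁)
        refine h.trans (le_of_eq ?_)
        unfold smBound
        ring

/-- **(64)–(70)**: for `k ≥ 1`, `μ₀ ≤ μ₂`, `0 < H ≤ k^{μ₂}`, `1 ≤ W`, `1 ≤ M₀`, `N₀ ≤ N₁`,
`|S₃(s) − S₄(s)| ≤ 4 d R · smBound k μ₀ (k^{μ₂}/H) W (M₁−M₀) M₁ (N₁−N₀)`.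
[cite: MauduitRivat2015, (64)–(70)] [cite: Mullner2017, §5.4.2] -/
theorem norm_corrS3_sub_corrS4_le_sm (U : G →* unitaryGroup d ℂ) (f : ℕ → G) {k : ℕ} (hk : 0 < k)
    {μ₀ μ₁ μ₂ Hs : ℕ} (hμ : μ₀ ≤ μ₂) (hH : 0 < Hs) (hHK : Hs ≤ k ^ μ₂) (ϑ : ℝ) {M₀ M₁ N₀ N₁ : ℕ}
    (hM₀ : 1 ≤ M₀) (hN : N₀ ≤ N₁) (R s : ℕ) {W : ℕ} (hW : 1 ≤ W) :
    ‖corrS3 U f k μ₀ μ₁ μ₂ ϑ M₀ M₁ N₀ N₁ R s - corrS4 U f k μ₀ μ₁ μ₂ Hs ϑ M₀ M₁ N₀ N₁ R s‖ ≤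
      4 * Fintype.card d * R * smBound k μ₀ ((k ^ μ₂ : ℝ) / Hs) W (M₁ - M₀) M₁ (N₁ - N₀) := by
  have hX : (0 : ℝ) ≤ (k ^ μ₂ : ℝ) / Hs := by positivity
  set SM := smBound k μ₀ ((k ^ μ₂ : ℝ) / Hs) W (M₁ - M₀) M₁ (N₁ - N₀) with hSM
  have hSM0 : 0 ≤ SM := smBound_nonneg k μ₀ hX W _ _ _
  refine (norm_corrS3_sub_corrS4_le U f hk hμ hH hHK ϑ M₀ M₁ N₀ N₁ R s).trans ?_
  have hdiv : ∀ x : ℕ, (k ^ μ₂ : ℝ) / (Hs * gridDist (k ^ μ₀) x) =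
      (k ^ μ₂ : ℝ) / Hs / (gridDist (k ^ μ₀) x : ℝ) := fun x => by rw [div_div]
  have hr : ∀ r ∈ Ico 1 R, ∑ n ∈ Ico N₀ N₁, ∑ m ∈ (Ico M₀ M₁).filter (fun m => m + s * k ^ μ₁ < M₁),
      (min 1 ((k ^ μ₂ : ℝ) / (Hs * gridDist (k ^ μ₀) (m * n))) +
        min 1 ((k ^ μ₂ : ℝ) / (Hs * gridDist (k ^ μ₀) (m * n + m * r)))) ≤ SM + SM := by
    intro r _
    simp only [hdiv, sum_add_distrib]
    refine add_le_add ?_ ?_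
    · have h := sum_sum_filter_min_le_box (μ₀ := μ₀) hk hX hW hM₀ hN (s * k ^ μ₁) 0 (M₁ := M₁) (N₁ := N₁)
      simp only [mul_zero, add_zero] at h
      exact h
    · exact sum_sum_filter_min_le_box (μ₀ := μ₀) hk hX hW hM₀ hN (s * k ^ μ₁) r
  calc 2 * (Fintype.card d : ℝ) * ∑ r ∈ Ico 1 R, ∑ n ∈ Ico N₀ N₁,
        ∑ m ∈ (Ico M₀ M₁).filter (fun m => m + s * k ^ μ₁ < M₁),
          (min 1 ((k ^ μ₂ : ℝ) / (Hs * gridDist (k ^ μ₀) (m * n))) +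
            min 1 ((k ^ μ₂ : ℝ) / (Hs * gridDist (k ^ μ₀) (m * n + m * r))))
      ≤ 2 * (Fintype.card d : ℝ) * ∑ _r ∈ Ico 1 R, (SM + SM) :=
        mul_le_mul_of_nonneg_left (sum_le_sum hr) (by positivity)
    _ = 2 * (Fintype.card d : ℝ) * (((R - 1 : ℕ) : ℝ) * (SM + SM)) := by
        rw [sum_const, Nat.card_Ico, nsmul_eq_mul]
    _ ≤ 2 * (Fintype.card d : ℝ) * ((R : ℝ) * (SM + SM)) := by
        have : ((R - 1 : ℕ) : ℝ) ≤ R := by exact_mod_cast Nat.sub_le R 1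
        gcongr
    _ = _ := by ring

/-! ## (71)–(72): `S₄(s)` through `S₄'(r,s)` and `S₄''(r,s)` -/

/-- `|S₄(s)| ≤ ∑_{1≤r<R} (|S₄'(r,s)| + |S₄''(r,s)|)` (`k ≥ 1`, `μ₀ ≤ μ₁ ≤ μ₂`).
[cite: MauduitRivat2015, (71)–(72)] -/
theorem norm_corrS4_le_sum (U : G →* unitaryGroup d ℂ) (f : ℕ → G) {k : ℕ} (hk : 0 < k)
    {μ₀ μ₁ μ₂ : ℕ} (h01 : μ₀ ≤ μ₁) (h12 : μ₁ ≤ μ₂) (Hs : ℕ) (ϑ : ℝ) (M₀ M₁ N₀ N₁ R s : ℕ) :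
    ‖corrS4 U f k μ₀ μ₁ μ₂ Hs ϑ M₀ M₁ N₀ N₁ R s‖ ≤
      ∑ r ∈ Ico 1 R, (‖corrS4rDiag U f k μ₀ μ₁ μ₂ Hs M₀ M₁ N₀ N₁ r s‖ +
        ‖corrS4rOff U f k μ₀ μ₁ μ₂ Hs M₀ M₁ N₀ N₁ r s‖) := by
  rw [corrS4_eq_sum_corrS4r]
  refine (norm_sum_le _ _).trans (sum_le_sum fun r _ => ?_)
  rw [norm_mul, norm_fourierChar, one_mul, corrS4r_eq_diag_add_off U f hk h01 h12]
  exact norm_add_le _ _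

/-! ## The chain for `∑_s |S₂'(s)|` -/

/-- **(62)–(72) chained and summed over `s`**: for `k ≥ 1`, `μ₀ ≤ μ₁ ≤ μ₂`, `0 < H ≤ k^{μ₂}`,
`1 ≤ W`, `1 ≤ M₀`, `N₀ ≤ N₁`, `#(midViolations) ≤ nB`,
`∑_{1≤s<S} |S₂'(s)| ≤ S · (8dR·scBound + 4dR·smBound) + ∑_s∑_r |S₄'(r,s)| + ∑_s∑_r |S₄''(r,s)|`.
[cite: MauduitRivat2015, (55)–(72)] [cite: Mullner2017, §5.4.2] -/
theorem sum_norm_corrS2_le_chain (U : G →* unitaryGroup d ℂ) (f : ℕ → G) {k : ℕ} (hk : 0 < k)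
    {μ₀ μ₁ μ₂ Hs : ℕ} (h01 : μ₀ ≤ μ₁) (h12 : μ₁ ≤ μ₂) (hH : 0 < Hs) (hHK : Hs ≤ k ^ μ₂) (ϑ : ℝ)
    {M₀ M₁ N₀ N₁ : ℕ} (hM₀ : 1 ≤ M₀) (hN : N₀ ≤ N₁) (R S : ℕ) {W : ℕ} (hW : 1 ≤ W) {nB : ℝ}
    (hnB : ((midViolations k μ₀ μ₁ μ₂ f).card : ℝ) ≤ nB) :
    ∑ s ∈ Ico 1 S, ‖corrS2 ϑ (umat U (trunc k μ₂ f)) M₀ M₁ N₀ N₁ R (k ^ μ₁) s‖ ≤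
      (S : ℝ) * (8 * Fintype.card d * R * scBound k μ₀ μ₂ nB (M₁ - M₀) M₁ (N₁ - N₀) +
          4 * Fintype.card d * R * smBound k μ₀ ((k ^ μ₂ : ℝ) / Hs) W (M₁ - M₀) M₁ (N₁ - N₀)) +
        ∑ s ∈ Ico 1 S, ∑ r ∈ Ico 1 R, ‖corrS4rDiag U f k μ₀ μ₁ μ₂ Hs M₀ M₁ N₀ N₁ r s‖ +
        ∑ s ∈ Ico 1 S, ∑ r ∈ Ico 1 R, ‖corrS4rOff U f k μ₀ μ₁ μ₂ Hs M₀ M₁ N₀ N₁ r s‖ := by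
  have h02 : μ₀ ≤ μ₂ := h01.trans h12
  have hnB0 : 0 ≤ nB := le_trans (Nat.cast_nonneg _) hnB
  set SC := scBound k μ₀ μ₂ nB (M₁ - M₀) M₁ (N₁ - N₀) with hSC
  set SM := smBound k μ₀ ((k ^ μ₂ : ℝ) / Hs) W (M₁ - M₀) M₁ (N₁ - N₀) with hSM
  have hSC0 : 0 ≤ SC := scBound_nonneg k μ₀ μ₂ hnB0 _ _ _
  have hSM0 : 0 ≤ SM := smBound_nonneg k μ₀ (by positivity) W _ _ _
  have hs : ∀ s ∈ Ico 1 S, ‖corrS2 ϑ (umat U (trunc k μ₂ f)) M₀ M₁ N₀ N₁ R (k ^ μ₁) s‖ ≤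
      (8 * Fintype.card d * R * SC + 4 * Fintype.card d * R * SM) +
        (∑ r ∈ Ico 1 R, ‖corrS4rDiag U f k μ₀ μ₁ μ₂ Hs M₀ M₁ N₀ N₁ r s‖ +
          ∑ r ∈ Ico 1 R, ‖corrS4rOff U f k μ₀ μ₁ μ₂ Hs M₀ M₁ N₀ N₁ r s‖) := by
    intro s _
    have a := norm_corrS2_sub_corrS3_le_sc U f hk h01 h12 ϑ hM₀ hN R s hnB (M₁ := M₁) (N₁ := N₁)
    have b := norm_corrS3_sub_corrS4_le_sm U f hk h02 hH hHK ϑ hM₀ hN R s hW (μ₁ := μ₁) (M₁ := M₁) (N₁ := N₁)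
    have c := norm_corrS4_le_sum U f hk h01 h12 Hs ϑ M₀ M₁ N₀ N₁ R s
    rw [sum_add_distrib] at c
    have tri : ‖corrS2 ϑ (umat U (trunc k μ₂ f)) M₀ M₁ N₀ N₁ R (k ^ μ₁) s‖ ≤
        ‖corrS2 ϑ (umat U (trunc k μ₂ f)) M₀ M₁ N₀ N₁ R (k ^ μ₁) s -
            corrS3 U f k μ₀ μ₁ μ₂ ϑ M₀ M₁ N₀ N₁ R s‖ +
          ‖corrS3 U f k μ₀ μ₁ μ₂ ϑ M₀ M₁ N₀ N₁ R s - corrS4 U f k μ₀ μ₁ μ₂ Hs ϑ M₀ M₁ N₀ N₁ R s‖ +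
          ‖corrS4 U f k μ₀ μ₁ μ₂ Hs ϑ M₀ M₁ N₀ N₁ R s‖ := by
      have := norm_add₃_le (a := corrS2 ϑ (umat U (trunc k μ₂ f)) M₀ M₁ N₀ N₁ R (k ^ μ₁) s -
            corrS3 U f k μ₀ μ₁ μ₂ ϑ M₀ M₁ N₀ N₁ R s)
          (b := corrS3 U f k μ₀ μ₁ μ₂ ϑ M₀ M₁ N₀ N₁ R s - corrS4 U f k μ₀ μ₁ μ₂ Hs ϑ M₀ M₁ N₀ N₁ R s)
          (c := corrS4 U f k μ₀ μ₁ μ₂ Hs ϑ M₀ M₁ N₀ N₁ R s)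
      simpa only [sub_add_sub_cancel, sub_add_cancel] using this
    linarith
  refine (sum_le_sum hs).trans ?_
  simp only [sum_add_distrib, sum_const, Nat.card_Ico, nsmul_eq_mul]
  have hS1 : ((S - 1 : ℕ) : ℝ) ≤ S := by exact_mod_cast Nat.sub_le S 1
  have hA : 0 ≤ 8 * (Fintype.card d : ℝ) * R * SC := by positivity
  have hB' : 0 ≤ 4 * (Fintype.card d : ℝ) * R * SM := by positivity
  have hA' : 0 ≤ 8 * (Fintype.card d : ℝ) * R * SC + 4 * (Fintype.card d : ℝ) * R * SM := by positivity
  nlinarith [mul_le_mul_of_nonneg_right hS1 hA, mul_le_mul_of_nonneg_right hS1 hB',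
    mul_le_mul_of_nonneg_right hS1 hA']

end Literature.NumberTheory.LFunctions.MauduitRivat
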